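import Summits.Ventures.HodgeRepro2.T5SU11XiTransform

/-!
# The Jacobi transforms of the weight-3 and weight-4 coefficient moduli in elementary form:
`m̂_3(λ) = 2π(1 − λ)/cos(πλ/2)`, `m̂_4(λ) = π² λ(2 − λ)/(4 sin(πλ/2))`

For the two lowest weights the Gamma quotient of `T5SU11JacobiTransform` collapses, by Euler's
reflection formula `Γ(z) Γ(1 − z) = π/sin(πz)` (`Real.Gamma_mul_Gamma_one_sub`), to elementary
functions of `λ`: **`∫_G (1 − |g·0|²)^{3/2} φ_λ(g) dν = 2π(1 − λ)/cos(πλ/2)`** for `−1 < λ < 3`, `λ ≠ 1`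
(`integral_orbit_rpow_three_mul_sph`), with the removable value **`4`** at the critical parameter
`λ = 1` (`integral_orbit_rpow_three_mul_sph_one`, `= C_3²` from `T5SU11XiTransform`), and
**`∫_G (1 − |g·0|²)^{2} φ_λ(g) dν = π² λ(2 − λ)/(4 sin(πλ/2))`** for `0 < λ < 4`, `λ ≠ 2`
(`integral_orbit_rpow_four_mul_sph`), with the value **`π²/4`** at `λ = 1` and `π` at `λ = 0, 2`. These are
the transforms for the weights `k = 3` (the representation `π₃⁺` of the owner's datum) and `k = 4`, each
checked at the parameters where both forms are defined. Nothing is claimed about (N).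

Blind lane: Mathlib + the HodgeRepro2 prefix only; no sorry; axioms ⊆ {propext, Classical.choice,
Quot.sound}.
-/

namespace Summit.Ventures.HodgeRepro2.T5SU11JacobiThreeFour

open MeasureTheory MeasureTheory.Measure Metric Set Filter Topology
open T5SU11Unimodular T5SU11Fibration T5SU11Cartan T5HaarCircle T5BergmanCoefficient
  T5SU11FibrationHaar T5SU11SphericalFunction T5SU11JacobiIwasawa T5SU11JacobiTransform
  T5SU11XiTransform
open scoped Real

/-! ### The Abel constants `C_3 = 2`, `C_4 = π/2` -/

/-- `Γ(3/2) = √π/2`. -/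
lemma Gamma_three_div_two : Real.Gamma (3 / 2) = √π / 2 := by
  rw [show (3 / 2 : ℝ) = 1 / 2 + 1 by norm_num, Real.Gamma_add_one (by norm_num), Real.Gamma_one_half_eq]
  ring

/-- `C_3 = √π Γ(1)/Γ(3/2) = 2`. -/
lemma abel_const_three : √π * Real.Gamma ((3 - 1) / 2) / Real.Gamma (3 / 2) = 2 := by
  rw [show ((3 : ℝ) - 1) / 2 = 1 by norm_num, Real.Gamma_one, Gamma_three_div_two]
  have hs : 0 < √π := Real.sqrt_pos.mpr Real.pi_pos
  field_simp

/-- `C_4 = √π Γ(3/2)/Γ(2) = π/2`. -/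
lemma abel_const_four : √π * Real.Gamma ((4 - 1) / 2) / Real.Gamma (4 / 2) = π / 2 := by
  rw [show ((4 : ℝ) - 1) / 2 = 3 / 2 by norm_num, show (4 : ℝ) / 2 = 2 by norm_num, Real.Gamma_two,
    Gamma_three_div_two, div_one, ← mul_div_assoc, Real.mul_self_sqrt Real.pi_pos.le]

/-- `sin(πz) ≠ 0` for `0 < z < 2`, `z ≠ 1`. -/
lemma sin_pi_mul_ne_zero {z : ℝ} (h0 : 0 < z) (h2 : z < 2) (h1 : z ≠ 1) : Real.sin (π * z) ≠ 0 := by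
  intro h
  obtain ⟨n, hn⟩ := Real.sin_eq_zero_iff.mp h
  have hπ : π ≠ 0 := Real.pi_pos.ne'
  have hnz : (n : ℝ) = z := by
    have : (n : ℝ) * π = z * π := by rw [hn]; ring
    exact mul_right_cancel₀ hπ this
  have hn0 : (0 : ℤ) < n := by exact_mod_cast (hnz ▸ h0 : (0 : ℝ) < n)
  have hn2 : n < (2 : ℤ) := by exact_mod_cast (hnz ▸ h2 : (n : ℝ) < 2)
  have : n = 1 := by omega
  apply h1
  rw [← hnz, this]
  norm_num

section measure

variable [MeasurableSpace Circle] [BorelSpace Circle]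

/-! ### Weight `3` -/

/-- **The weight-3 transform in elementary form**: for `−1 < λ < 3`, `λ ≠ 1`,
`∫_G (1 − |g·0|²)^{3/2} φ_λ(g) dν = 2π(1 − λ)/cos(πλ/2)`. -/
theorem integral_orbit_rpow_three_mul_sph {lam : ℝ} (h1 : -1 < lam) (h2 : lam < 3) (h3 : lam ≠ 1) :
    ∫ g, (1 - ‖orbit g‖ ^ 2) ^ ((3 : ℝ) / 2) * sph lam g ∂(nu haarCircle)
      = 2 * π * (1 - lam) / Real.cos (π * lam / 2) := by
  rw [integral_orbit_rpow_mul_sph (k := 3) (by norm_num) (by linarith) (by linarith),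
    abel_const_three, show (3 : ℝ) - 2 = 1 by norm_num, Real.rpow_one, show (3 : ℝ) - 1 = 2 by norm_num,
    Real.Gamma_two]
  -- `Γ((3 − λ)/2) = (1 − (1+λ)/2) Γ(1 − (1+λ)/2)` and the reflection formula at `z = (1+λ)/2`
  set z : ℝ := (1 + lam) / 2 with hz
  have e1 : (3 - lam) / 2 = (1 - z) + 1 := by rw [hz]; ring
  have e2 : (3 + lam) / 2 - 1 = z := by rw [hz]; ring
  have hz1 : 1 - z ≠ 0 := by
    intro h
    apply h3
    rw [hz] at h
    linarith
  rw [e1, e2, Real.Gamma_add_one hz1]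
  have hrefl := Real.Gamma_mul_Gamma_one_sub z
  have hcos : Real.sin (π * z) = Real.cos (π * lam / 2) := by
    rw [hz, show π * ((1 + lam) / 2) = π * lam / 2 + π / 2 by ring, Real.sin_add_pi_div_two]
  have hcos0 : Real.cos (π * lam / 2) ≠ 0 := by
    rw [← hcos]
    refine sin_pi_mul_ne_zero ?_ ?_ ?_
    · rw [hz]; linarith
    · rw [hz]; linarith
    · intro h; apply h3; rw [hz] at h; linarith
  rw [div_one, show 2 * 2 * ((1 - z) * Real.Gamma (1 - z) * Real.Gamma z)
      = 4 * (1 - z) * (Real.Gamma z * Real.Gamma (1 - z)) by ring, hrefl, hcos, hz]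
  field_simp
  ring

/-- **The critical value**: `∫_G (1 − |g·0|²)^{3/2} Ξ(g) dν = 4` (the removable value of
`2π(1 − λ)/cos(πλ/2)` at `λ = 1`; `= C_3²`). -/
theorem integral_orbit_rpow_three_mul_sph_one :
    ∫ g, (1 - ‖orbit g‖ ^ 2) ^ ((3 : ℝ) / 2) * sph 1 g ∂(nu haarCircle) = 4 := by
  rw [integral_orbit_rpow_mul_sph_one_eq_sq (by norm_num), abel_const_three]
  norm_num

/-- `∫_G (1 − |g·0|²)^{3/2} dν = 2π` (`λ = 0`). -/
theorem integral_orbit_rpow_three :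
    ∫ g, (1 - ‖orbit g‖ ^ 2) ^ ((3 : ℝ) / 2) ∂(nu haarCircle) = 2 * π := by
  rw [integral_orbit_rpow_nu (by norm_num)]
  norm_num

/-! ### Weight `4` -/

/-- **The weight-4 transform in elementary form**: for `0 < λ < 4`, `λ ≠ 2`,
`∫_G (1 − |g·0|²)^{2} φ_λ(g) dν = π² λ(2 − λ)/(4 sin(πλ/2))`. -/
theorem integral_orbit_rpow_four_mul_sph {lam : ℝ} (h1 : 0 < lam) (h2 : lam < 4) (h3 : lam ≠ 2) :
    ∫ g, (1 - ‖orbit g‖ ^ 2) ^ ((4 : ℝ) / 2) * sph lam g ∂(nu haarCircle)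
      = π ^ 2 * lam * (2 - lam) / (4 * Real.sin (π * lam / 2)) := by
  rw [integral_orbit_rpow_mul_sph (k := 4) (by norm_num) (by linarith) (by linarith),
    abel_const_four, show (4 : ℝ) - 2 = 2 by norm_num, Real.rpow_two, show (4 : ℝ) - 1 = 3 by norm_num,
    show Real.Gamma 3 = 2 by
      rw [show (3 : ℝ) = 2 + 1 by norm_num, Real.Gamma_add_one (by norm_num), Real.Gamma_two]; ring]
  -- `Γ(2 − λ/2) = (1 − λ/2) Γ(1 − λ/2)`, `Γ(1 + λ/2) = (λ/2) Γ(λ/2)`, reflection at `z = λ/2`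
  set z : ℝ := lam / 2 with hz
  have e1 : (4 - lam) / 2 = (1 - z) + 1 := by rw [hz]; ring
  have e2 : (4 + lam) / 2 - 1 = z + 1 := by rw [hz]; ring
  have hz0 : z ≠ 0 := by rw [hz]; exact div_ne_zero h1.ne' two_ne_zero
  have hz1 : 1 - z ≠ 0 := by
    intro h
    apply h3
    rw [hz] at h
    linarith
  rw [e1, e2, Real.Gamma_add_one hz1, Real.Gamma_add_one hz0]
  have hrefl := Real.Gamma_mul_Gamma_one_sub z
  have hsin0 : Real.sin (π * z) ≠ 0 := by
    refine sin_pi_mul_ne_zero ?_ ?_ ?_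
    · rw [hz]; linarith
    · rw [hz]; linarith
    · intro h; apply h3; rw [hz] at h; linarith
  rw [show (2 : ℝ) ^ 2 * (π / 2) * ((1 - z) * Real.Gamma (1 - z) * (z * Real.Gamma z) / 2)
      = π * z * (1 - z) * (Real.Gamma z * Real.Gamma (1 - z)) by ring, hrefl, hz,
    show π * (lam / 2) = π * lam / 2 by ring]
  field_simp
  ring

/-- **The critical value**: `∫_G (1 − |g·0|²)^{2} Ξ(g) dν = π²/4` (`= C_4²`). -/
theorem integral_orbit_rpow_four_mul_sph_one :
    ∫ g, (1 - ‖orbit g‖ ^ 2) ^ ((4 : ℝ) / 2) * sph 1 g ∂(nu haarCircle) = π ^ 2 / 4 := by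
  rw [integral_orbit_rpow_mul_sph_one_eq_sq (by norm_num), abel_const_four]
  ring

/-- `∫_G (1 − |g·0|²)^{2} dν = π` (`λ = 0`; the formal-degree integral of weight `2` in the `k`-convention
of `T5SU11CoeffPowCartan`). -/
theorem integral_orbit_rpow_four :
    ∫ g, (1 - ‖orbit g‖ ^ 2) ^ ((4 : ℝ) / 2) ∂(nu haarCircle) = π := by
  rw [integral_orbit_rpow_nu (by norm_num)]
  norm_num

end measure

end Summit.Ventures.HodgeRepro2.T5SU11JacobiThreeFour
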